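import Summits.NavierStokesRegularity.NavierStokesRegularity.Theorems.ScenarioCensusAgeingMeterRows
import Summits.NavierStokesRegularity.NavierStokesRegularity.Theorems.ScenarioCensusSilenceMeterRows
import Summits.NavierStokesRegularity.NavierStokesRegularity.Theorems.ScenarioCensusHullMeter
import HarnessLib

/-!
# AGEING METER port, part 4/5: §F′ (REV 2) FUTURE-VERTEX PLACEMENT — `Row_A2agFf` (fine factors) DECIDED, the open cell `Row_A2agF` is EXACTLY apex-DSS Liouville at the same factor
# (`row_A2agF_iff`, `row_A2agF_iff_global`, `row_A2agF_iff_coarsePastLiouville`; HULL METER's past truncation / `PastInvariant` / `PastLiouville` BY NAME)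

Re-homed for the scenario census (typer seat ns-census-typer-1 g10; the cells A2agT / A2agV / A2ag0 / A2agU / A2agFf / A2ag2v are MEMBERS OF RECORD «DECIDED IN KERNEL IN FILES» of row
A2 (item 77: REV 1 critic PASS tier B, REV 3 idea-crit-3 g10 ROW WORDS BY KEY 11:55:14Z; ref PRE-CHECK ✓ §18.27 / §18.37; lead label), A2agF OPEN ≡ D7; this port makes the decided
cells TREE-decided): VERBATIM PORT of ns-idea-2 LINE g17-2 «ageing-meter» REV 3, `pub/ideators/ns-idea-2/lines/ageing-meter/line-ageing-meter.rev3.lean` sha16 a9c9c668d639c4c6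
(1173 l., lean check rc 0, 0 sorry), split for the 400-line rule into `ScenarioCensusAgeingMeter` (§A–§C) → `…AgeingMeterLaw` (§D–§E) → `…AgeingMeterRows` (§F–§G) →
`…AgeingMeterVertex` (§F′) → `…AgeingMeterTwoVertex` (§F″, §H + census KEYS).  Lean text VERBATIM in namespace `…Theorems.ScenarioCensus.AgeingMeter` (the line's
`…Lines.AgeingMeter` re-homed); port edits: the line's `local notation "E3"` is spelled as the reducible `abbrev E3` of every census file; declarations the line restates VERBATIM
from the landed SILENCE METER (`simBall`, `simBall_neg_one`, `smul_mem_simBall`, `e₀`, `norm_e₀`) and HULL METER (`pastPart`, `pastPart_of_neg`, `pastPart_of_not_neg`,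
`isTypeIAncientMild_pastPart`, `isDiscretelySelfSimilar_pastPart`, `PastInvariant`, `PastLiouville`) ports are taken BY NAME (gate lint dedup.landed); `set_option
linter.unusedVariables false` dropped (binders the linter names are `_`-prefixed); `@[conjecture]` on the OPEN row `Row_A2agF` (≡ census D7); one-line docstrings added where missing
(gate lint).  Statements untouched.

No census VALUE is moved here (row A2 stays OPEN-WITH-LINE; the members become TREE-decided by name); D7 / (L′) are NOT proved; no summit statement is proved by this file. Lemmas that restate already-landed tree declarations are taken BY NAME (gate lint `dedup.landed`): `simBall` = `SilenceMeter.simBall`, `smul_mem_simBall` = `SilenceMeter.smul_mem_simBall`, `e₀` = `SilenceMeter.e₀`, `pastPart` = `HullMeter.pastPart`, `isTypeIAncientMild_pastPart` = `HullMeter.isTypeIAncientMild_pastPart`, `isDiscretelySelfSimilar_pastPart` = `HullMeter.isDiscretelySelfSimilar_pastPart`, `PastInvariant` = `HullMeter.PastInvariant`, `PastLiouville` = `HullMeter.PastLiouville`.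
-/

-- the summit and its single problem share the name `NavierStokesRegularity` (D-0017 nested layout)
set_option linter.dupNamespace false

noncomputable section

open Set Function Filter Metric
open scoped Topology
open Literature.Analysis Literature.Analysis.FluidPDE
open Summit.NavierStokesRegularity.NavierStokesRegularity.Theorems
open Summit.NavierStokesRegularity.NavierStokesRegularity.Theorems.ScenarioCensus.ScrewBlowdown
open Summit.NavierStokesRegularity.NavierStokesRegularity.Theorems.NearExtremalTransiencePerFlow.FilamentSelection
open Summit.NavierStokesRegularity.NavierStokesRegularity.Cruxes.ScarEnvelopeTypeI.AxisActivity

namespace Summit.NavierStokesRegularity.NavierStokesRegularity.Theorems.ScenarioCensus.AgeingMeter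

variable {C : ℝ} {u : ℝ → E3 → E3}

/-! ## F′. (REV 2) FUTURE-VERTEX PLACEMENT — the open cell `Row_A2agF` is EXACTLY apex-DSS Liouville at the same factor

The composite «zoom by `λ > 1` then age by `δ > 0`» has its fixed vertex `t_T = λ²δ/(λ²−1)` in the FUTURE.  REV 2
places this cell: for every `C` and every `λ > 1`, the future-vertex Liouville statement at `(C, λ)` is EQUIVALENT to
the apex-DSS Liouville statement at `(C, λ)` (`futureVertexLiouville_iff`), by two explicit moves inside `A_C`:
(→) time-ADVANCE an apex-DSS element by `t_T` (`comp_sub_right`): it becomes future-vertex recurrent;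
(←) globalise the germ recurrence (`germRigidity`), blow DOWN along the factor powers `λⁿ` — along these scales the
zooms are exact forward TIME-TRANSLATES `u(· + t_T(1 − λ⁻²ⁿ), ·)` of `u`, so the blow-down limit `W ∈ A_C` (KNSS
extraction) is the forward translate `u(· + t_T, ·)` on `t < −t_T` (continuity in time), it is apex-`λ`-DSS on a germ,
hence on the past (`dss_of_germ`), the apex Liouville kills `W`, and `u(t, x) = W(t − t_T, x) = 0`.
Consequently the FINE future-vertex cell `1 < λ < c₁(C)` is DECIDED (`row_A2agFf`, from the tree's near-one RATE rung
`NearOneRateDss`, census D5r, via past truncation), and the open row is literally `∀ C, ∀ λ > 1, ApexDssLiouville C λ`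
(`row_A2agF_iff`) — census D7 (coarse backward DSS in the rate class) and nothing else.  The vertex trichotomy of the
ageing meter is thus fully placed: DRIFT decided · INTERIOR decided · FUTURE-fine decided · FUTURE-coarse = D7. -/

/-- APEX-DSS LIOUVILLE on the past at `(C, λ)`: every `u ∈ A_C` with `λu(λ²t, λx) = u(t, x)` for `t < 0` vanishes on
the past.  (Fine `λ`: the tree's `NearOneRateDss`, D5r — `apexDssLiouville_fine`; coarse `λ`: census D7, OPEN.) -/
def ApexDssLiouville (C l : ℝ) : Prop :=
  ∀ u : ℝ → E3 → E3, IsTypeIAncientMild C u → (∀ t < (0 : ℝ), ∀ x, nsRescale l u t x = u t x) →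
    ∀ t < (0 : ℝ), ∀ x, u t x = 0

/-- The same with GLOBAL discrete self-similarity (`nsRescale λ u = u` as functions, the tree's phrasing). -/
def GlobalDssLiouville (C l : ℝ) : Prop :=
  ∀ u : ℝ → E3 → E3, IsTypeIAncientMild C u → IsDiscretelySelfSimilar l u → ∀ t < (0 : ℝ), ∀ x, u t x = 0

/-- FUTURE-VERTEX LIOUVILLE at `(C, λ)`: the per-factor form of `Row_A2agF`. -/
def FutureVertexLiouville (C l : ℝ) : Prop :=
  ∀ u : ℝ → E3 → E3, IsTypeIAncientMild C u → ∀ δ : ℝ, 0 < δ → ∀ t₀ < (0 : ℝ), ∀ U : Set E3, IsOpen U →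
    U.Nonempty → (∀ x ∈ U, l • u (l ^ 2 * (t₀ - δ)) (l • x) = u t₀ x) → ∀ t < (0 : ℝ), ∀ x, u t x = 0

-- `pastPart`: the line restates the tree's `HullMeter.pastPart`; taken BY NAME (gate lint dedup.landed).

-- `isTypeIAncientMild_pastPart`: the line restates the tree's `HullMeter.isTypeIAncientMild_pastPart`; taken BY NAME (gate lint dedup.landed).

-- `isDiscretelySelfSimilar_pastPart`: the line restates the tree's `HullMeter.isDiscretelySelfSimilar_pastPart`; taken BY NAME (gate lint dedup.landed).

/-- The past form and the global form of apex-DSS Liouville are the same statement. -/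
theorem apexDssLiouville_iff_global {l : ℝ} (hl : 0 < l) : ApexDssLiouville C l ↔ GlobalDssLiouville C l := by
  constructor
  · intro H u hu hdss
    exact H u hu fun t ht x => by rw [show nsRescale l u = u from hdss]
  · intro H u hu hdss t ht x
    have hz := H (HullMeter.pastPart u) (HullMeter.isTypeIAncientMild_pastPart hu) (HullMeter.isDiscretelySelfSimilar_pastPart hl hdss) t ht x
    rwa [HullMeter.pastPart_of_neg ht] at hz

/-- FINE apex factors are decided: the tree's near-one RATE rung `NearOneRateDss` (census D5r), BY NAME. -/
theorem apexDssLiouville_fine (C : ℝ) : ∃ c₁ : ℝ, 1 < c₁ ∧ ∀ l : ℝ, 1 < l → l < c₁ → ApexDssLiouville C l := by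
  obtain ⟨c₁, hc₁, H⟩ := nearOneRateDss_proof C
  exact ⟨c₁, hc₁, fun l h1 h2 =>
    (apexDssLiouville_iff_global (one_pos.trans h1)).2 fun u hu hdss => H l h1 h2 u hu hdss⟩

/-- GLOBALISATION: a «zoom by `λ` then age by `δ`» recurrence seen on a germ of one slice holds on the whole past
(class covariance `zoom_isTypeIAncientMild ∘ comp_sub_right` + `germRigidity`; any `λ > 0`, `δ > 0`). -/
theorem vertexRecurrent_global (hu : IsTypeIAncientMild C u) {l δ : ℝ} (hl : 0 < l) (hδ : 0 < δ)
    {t₀ : ℝ} (ht₀ : t₀ < 0) {U : Set E3} (hU : IsOpen U) (hne : U.Nonempty)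
    (heq : ∀ x ∈ U, l • u (l ^ 2 * (t₀ - δ)) (l • x) = u t₀ x) :
    ∀ t < 0, ∀ x, l • u (l ^ 2 * (t - δ)) (l • x) = u t x := by
  have hv : IsTypeIAncientMild C (nsRescale l (fun s => u (s - l ^ 2 * δ))) :=
    zoom_isTypeIAncientMild (hu.comp_sub_right (by positivity)) hl
  have hv' : ∀ t x, nsRescale l (fun s => u (s - l ^ 2 * δ)) t x = l • u (l ^ 2 * (t - δ)) (l • x) := by
    intro t x
    show l • u (l ^ 2 * t - l ^ 2 * δ) (l • x) = _
    rw [show l ^ 2 * t - l ^ 2 * δ = l ^ 2 * (t - δ) by ring]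
  intro t ht x
  rw [← hv']
  exact germRigidity hv hu ht₀ hU hne (fun y hy => by rw [hv']; exact heq y hy) ht x

/-- ITERATION along the affine time-action: `u(t, x) = λⁿ u(t_T + λ²ⁿ(t − t_T), λⁿ x)` for every `n`. -/
theorem vertexRecurrent_iter {l δ : ℝ} (hl : 0 < l) (hl1 : l ^ 2 ≠ 1) (hδ : 0 < δ)
    (hglob : ∀ t < (0 : ℝ), ∀ x, l • u (l ^ 2 * (t - δ)) (l • x) = u t x) :
    ∀ n : ℕ, ∀ t < (0 : ℝ), ∀ x, u t x = l ^ n • u (vertex l δ + (l ^ 2) ^ n * (t - vertex l δ)) (l ^ n • x) := by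
  intro n
  induction n with
  | zero =>
    intro t ht x
    simp
  | succ n ih =>
    intro t ht x
    have ht' : l ^ 2 * (t - δ) < 0 := mul_neg_of_pos_of_neg (by positivity) (by linarith)
    rw [← hglob t ht x, ih _ ht' (l • x), smul_smul, smul_smul, ← pow_succ', ← pow_succ, vertex_step hl1 t]
    congr 2
    ring

/-- **FUTURE VERTEX ⇐ APEX.**  Apex-DSS Liouville at `(C, λ)`, `λ > 1`, implies future-vertex Liouville at `(C, λ)`:
globalise; blow down along `λⁿ` (the zooms are forward time-translates of `u`); the KNSS limit is `u(· + t_T, ·)` on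
`t < −t_T`, apex-DSS on a germ hence on the past (`dss_of_germ`); the apex Liouville kills it, and with it `u`. -/
theorem futureVertexLiouville_of_apexDssLiouville {l : ℝ} (hl : 1 < l) (H : ApexDssLiouville C l) :
    FutureVertexLiouville C l := by
  intro u hu δ hδ t₀ ht₀ U hU hne heq
  have hl0 : 0 < l := one_pos.trans hl
  have hl2 : 1 < l ^ 2 := by nlinarith
  have hl2ne : l ^ 2 ≠ 1 := ne_of_gt hl2
  have hglob := vertexRecurrent_global hu hl0 hδ ht₀ hU hne heq
  set T : ℝ := vertex l δ with hTdef
  have hT : 0 < T := vertex_pos hl hδ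
  have hiter := vertexRecurrent_iter hl0 hl2ne hδ hglob
  -- the offsets `a n = T (1 − λ⁻²ⁿ) ↑ T`
  set a : ℕ → ℝ := fun n => T * (1 - ((l ^ 2) ^ n)⁻¹) with hadef
  have hapow : ∀ n : ℕ, 0 < (l ^ 2) ^ n := fun n => pow_pos (by positivity) n
  have ha_lt : ∀ n, a n < T := fun n => by
    have h1 : 0 < ((l ^ 2) ^ n)⁻¹ := inv_pos.2 (hapow n)
    have : T * (1 - ((l ^ 2) ^ n)⁻¹) < T * 1 := mul_lt_mul_of_pos_left (by linarith) hT
    simpa [hadef] using this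
  have ha_lim : Tendsto a atTop (𝓝 T) := by
    have h1 : Tendsto (fun n : ℕ => ((l ^ 2) ^ n)⁻¹) atTop (𝓝 0) :=
      tendsto_inv_atTop_zero.comp (tendsto_pow_atTop_atTop_of_one_lt hl2)
    have h2 : Tendsto (fun n : ℕ => T * (1 - ((l ^ 2) ^ n)⁻¹)) atTop (𝓝 (T * (1 - 0))) :=
      tendsto_const_nhds.mul (tendsto_const_nhds.sub h1)
    simpa [hadef] using h2
  -- along the factor powers the zooms are time-translates of `u`
  have hzoom : ∀ n : ℕ, ∀ t : ℝ, t + a n < 0 → ∀ x, nsRescale (l ^ n) u t x = u (t + a n) x := by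
    intro n t hta x
    rw [nsRescale_apply, hiter n (t + a n) hta x]
    have hpow : (l ^ n) ^ 2 = (l ^ 2) ^ n := by rw [← pow_mul, ← pow_mul, mul_comm]
    have hne : (l ^ 2) ^ n ≠ 0 := (hapow n).ne'
    have harg : T + (l ^ 2) ^ n * (t + a n - T) = (l ^ n) ^ 2 * t := by
      rw [hpow, hadef]
      field_simp
      ring
    rw [harg]
  -- KNSS extraction along `λⁿ`
  obtain ⟨φ, hφ, W, hW, hpt, -, -, -⟩ :=
    exists_tendsto_of_isTypeIAncientMild_seq C (w := fun n => nsRescale (l ^ n) u)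
      fun n => zoom_isTypeIAncientMild hu (pow_pos hl0 n)
  -- the limit is the forward time-translate of `u` on `t < −T`
  have hWu : ∀ t : ℝ, t < -T → ∀ x, W t x = u (t + T) x := by
    intro t ht x
    have htT : t + T < 0 := by linarith
    have hca : ContinuousAt (uncurry u) (t + T, x) :=
      hu.continuousOn_uncurry.continuousAt
        ((isOpen_Iio.prod isOpen_univ).mem_nhds ⟨htT, mem_univ _⟩)
    have hpath : Tendsto (fun n : ℕ => (t + a n, x)) atTop (𝓝 (t + T, x)) :=
      (tendsto_const_nhds.add ha_lim).prodMk_nhds tendsto_const_nhds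
    have hfull : Tendsto (fun n : ℕ => u (t + a n) x) atTop (𝓝 (u (t + T) x)) := hca.tendsto.comp hpath
    have hta : ∀ n, t + a n < 0 := fun n => by have := ha_lt n; linarith
    have hfull' : Tendsto (fun n : ℕ => nsRescale (l ^ n) u t x) atTop (𝓝 (u (t + T) x)) := by
      refine hfull.congr' (Eventually.of_forall fun n => ?_)
      exact (hzoom n t (hta n) x).symm
    exact tendsto_nhds_unique (hpt t (by linarith) x) (hfull'.comp hφ.tendsto_atTop)
  -- the limit is apex-`λ`-DSS on the germ of the slice `−2T`, hence on the whole past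
  have hgerm : ∀ y ∈ (univ : Set E3), nsRescale l W (-2 * T) y = W (-2 * T) y := by
    intro y _
    have h1 : l ^ 2 * (-2 * T) < -T := by nlinarith
    have h2 : -2 * T < -T := by linarith
    rw [nsRescale_apply, hWu _ h1, hWu _ h2]
    have h3 := hglob (-2 * T + T) (by linarith) y
    have h4 : l ^ 2 * (-2 * T + T - δ) = l ^ 2 * (-2 * T) + T := by
      rw [vertex_step hl2ne, ← hTdef]; ring
    rw [h4] at h3
    exact h3
  have hdss : ∀ s < (0 : ℝ), ∀ y, nsRescale l W s y = W s y := fun s hs y =>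
    dss_of_germ hW hl0 (show -2 * T < 0 by linarith) isOpen_univ univ_nonempty hgerm hs y
  have hW0 := H W hW hdss
  -- conclusion: `u(t, x) = W(t − T, x) = 0`
  intro t ht x
  have h := hWu (t - T) (by linarith) x
  rw [sub_add_cancel] at h
  rw [← h]
  exact hW0 (t - T) (by linarith) x

/-- **APEX ⇐ FUTURE VERTEX.**  Conversely, time-advancing an apex-DSS element by `t_T = vertex λ 1` produces a
future-vertex recurrent element of `A_C` (`comp_sub_right`); killing it kills the original on `t < −t_T`, and the
apex scaling carries the vanishing to the whole past. -/
theorem apexDssLiouville_of_futureVertexLiouville {l : ℝ} (hl : 1 < l) (H : FutureVertexLiouville C l) :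
    ApexDssLiouville C l := by
  intro U hU hdss
  have hl0 : 0 < l := one_pos.trans hl
  have hl2 : 1 < l ^ 2 := by nlinarith
  have hl2ne : l ^ 2 ≠ 1 := ne_of_gt hl2
  set T : ℝ := vertex l 1 with hTdef
  have hT : 0 < T := vertex_pos hl one_pos
  -- the time-advanced copy is future-vertex recurrent everywhere
  have hu : IsTypeIAncientMild C (fun s => U (s - T)) := hU.comp_sub_right hT.le
  have hrec : ∀ x ∈ (univ : Set E3), l • (fun s => U (s - T)) (l ^ 2 * (-1 - 1)) (l • x) =
      (fun s => U (s - T)) (-1) x := by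
    intro x _
    show l • U (l ^ 2 * (-1 - 1) - T) (l • x) = U (-1 - T) x
    have h1 : l ^ 2 * (-1 - 1) - T = l ^ 2 * (-1 - T) := by
      have := vertex_step hl2ne (δ := 1) (-1); rw [← hTdef] at this; linarith
    rw [h1, ← nsRescale_apply, hdss (-1 - T) (by linarith) x]
  have hz := H _ hu 1 one_pos (-1) (by norm_num) univ isOpen_univ univ_nonempty hrec
  -- hence `U = 0` on `t < −T` …
  have hfar : ∀ t : ℝ, t < -T → ∀ x, U t x = 0 := by
    intro t ht x
    have h := hz (t + T) (by linarith) x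
    simpa using h
  -- … and by the apex scaling on the whole past
  have hind : ∀ n : ℕ, ∀ t < (0 : ℝ), (l ^ 2) ^ n * t < -T → ∀ x, U t x = 0 := by
    intro n
    induction n with
    | zero => intro t ht h x; exact hfar t (by simpa using h) x
    | succ n ih =>
      intro t ht h x
      have hlt : l ^ 2 * t < 0 := mul_neg_of_pos_of_neg (by positivity) ht
      have h' : (l ^ 2) ^ n * (l ^ 2 * t) < -T := by rw [← mul_assoc, ← pow_succ]; exact h
      rw [← hdss t ht x, nsRescale_apply, ih _ hlt h' (l • x), smul_zero]
  intro t ht x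
  obtain ⟨n, hn⟩ := ((tendsto_pow_atTop_atTop_of_one_lt hl2).eventually_gt_atTop (-T / t)).exists
  exact hind n t ht (by have := (div_lt_iff_of_neg ht).1 hn; linarith) x

/-- **THE PLACEMENT**: for `λ > 1`, future-vertex Liouville and apex-DSS Liouville at `(C, λ)` are EQUIVALENT. -/
theorem futureVertexLiouville_iff {l : ℝ} (hl : 1 < l) : FutureVertexLiouville C l ↔ ApexDssLiouville C l :=
  ⟨apexDssLiouville_of_futureVertexLiouville hl, futureVertexLiouville_of_apexDssLiouville hl⟩

/-- FINE future vertices are decided. -/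
theorem futureVertexLiouville_fine (C : ℝ) :
    ∃ c₁ : ℝ, 1 < c₁ ∧ ∀ l : ℝ, 1 < l → l < c₁ → FutureVertexLiouville C l := by
  obtain ⟨c₁, hc₁, H⟩ := apexDssLiouville_fine C
  exact ⟨c₁, hc₁, fun l h1 h2 => futureVertexLiouville_of_apexDssLiouville h1 (H l h1 h2)⟩

/-- **Row A2ag-F′ (FINE FUTURE VERTEX — EXCLUDED, PROVED).**  For every `C` there is `c₁(C) > 1` such that a germ of
one slice of `u ∈ A_C` recurring under «zoom by `λ ∈ (1, c₁)` then age by `δ > 0`» forces `u ≡ 0` on the past. -/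
def Row_A2agFf : Prop :=
  ∀ C : ℝ, ∃ c₁ : ℝ, 1 < c₁ ∧ ∀ u : ℝ → E3 → E3, IsTypeIAncientMild C u →
    (∃ l δ : ℝ, 1 < l ∧ l < c₁ ∧ 0 < δ ∧ ∃ t₀ < (0 : ℝ), ∃ U : Set E3, IsOpen U ∧ U.Nonempty ∧
      ∀ x ∈ U, l • u (l ^ 2 * (t₀ - δ)) (l • x) = u t₀ x) →
    ∀ t < (0 : ℝ), ∀ x, u t x = 0

/-- **Row A2agFf holds** (fine future-vertex factors). -/
theorem row_A2agFf : Row_A2agFf := by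
  intro C
  obtain ⟨c₁, hc₁, H⟩ := futureVertexLiouville_fine C
  refine ⟨c₁, hc₁, fun u hu hcell => ?_⟩
  obtain ⟨l, δ, h1, h2, hδ, t₀, ht₀, U, hU, hne, heq⟩ := hcell
  exact H l h1 h2 u hu δ hδ t₀ ht₀ U hU hne heq

/-- **PLACEMENT OF THE OPEN ROW**: `Row_A2agF` is literally apex-DSS Liouville at every factor `λ > 1` and every
`C` — census D7 (backward DSS in the Type-I RATE class, coarse factors) given the decided fine factors. -/
theorem row_A2agF_iff : Row_A2agF ↔ ∀ C l : ℝ, 1 < l → ApexDssLiouville C l := by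
  constructor
  · intro hF C l hl
    exact apexDssLiouville_of_futureVertexLiouville hl fun u hu δ hδ t₀ ht₀ U hU hne heq =>
      hF C u hu ⟨l, δ, hl, hδ, t₀, ht₀, U, hU, hne, heq⟩
  · rintro H C u hu ⟨l, δ, hl, hδ, t₀, ht₀, U, hU, hne, heq⟩
    exact futureVertexLiouville_of_apexDssLiouville hl (H C l hl) u hu δ hδ t₀ ht₀ U hU hne heq

/-- The same placement in the tree's GLOBAL-DSS phrasing (`IsDiscretelySelfSimilar`, as in `NearOneRateDss`). -/
theorem row_A2agF_iff_global : Row_A2agF ↔ ∀ C l : ℝ, 1 < l → GlobalDssLiouville C l := by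
  rw [row_A2agF_iff]
  exact forall_congr' fun C => forall_congr' fun l => forall_congr' fun hl =>
    apexDssLiouville_iff_global (one_pos.trans hl)

/-! ### F′.1  The same wall as the hull meter (g17-1): `Row_A2agF` ⟺ coarse PAST LIOUVILLE (verbatim hull-meter phrasing) -/

-- `PastInvariant`: the line restates the tree's `HullMeter.PastInvariant`; taken BY NAME (gate lint dedup.landed).

-- `PastLiouville`: the line restates the tree's `HullMeter.PastLiouville`; taken BY NAME (gate lint dedup.landed).

/-- Apex-DSS Liouville at factor `l` is EXACTLY the past Liouville property of `{l}`. -/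
theorem apexDssLiouville_iff_pastLiouville {l : ℝ} : ApexDssLiouville C l ↔ HullMeter.PastLiouville C {l} := by
  constructor
  · intro H W hW hinv
    exact H W hW (hinv l rfl)
  · intro H u hu hdss
    exact H u hu fun c hc => by rw [mem_singleton_iff] at hc; subst hc; exact hdss

/-- **SAME WALL**: the ageing meter's open row is the hull meter's open dial — `Row_A2agF ⟺ ∀ C λ > 1, HullMeter.PastLiouville C {λ}`
(= g17-1 `CoarsePastLiouville`, there proved `↔ Row_A2huL ↔ CoarseGapLaw`); all four are census D7 in (L′)-shape. -/
theorem row_A2agF_iff_coarsePastLiouville : Row_A2agF ↔ ∀ C l : ℝ, 1 < l → HullMeter.PastLiouville C {l} := by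
  rw [row_A2agF_iff]
  exact forall_congr' fun C => forall_congr' fun l => forall_congr' fun _ => apexDssLiouville_iff_pastLiouville

end Summit.NavierStokesRegularity.NavierStokesRegularity.Theorems.ScenarioCensus.AgeingMeter

end
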